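import Summits.KontsevichZagierPeriods.KontsevichZagierPeriods.Theses.FurushoPentagon
import Literature.NumberTheory.Transcendental.KZLogCalculusProofs

/-!
# `ReducedPeriodRing` (stmt-KontsevichZagierPeriods-3929) — the positive cone (boundary lemmas)

Where the crux `∀ c, c * c ∈ KZ.relations → c ∈ KZ.relations` provably HOLDS, and the sign-free
statement it is EQUIVALENT to. Tools: an a.e.-vanishing integrand gives a relation (domain
additivity along the Tarski–Seidenberg split `σ = {f = 0} ∪ {f ≠ 0}`; null domains and zero
integrands are the tree's `KZ.of_mem_relations_of_volume_eq_zero/…_of_eqOn_zero`). Results: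
* the kernel conjecture holds on the POSITIVE CONE (sums of representations with non-negative
  integrands): `mem_relations_of_mem_cone_of_eval_eq_zero`; hence no nilpotent lies in `±cone`
  (`reducedPeriodRing_on_cone`) — a counterexample to the crux needs signed cancellation;
* every formal combination is `P − Q` with `P, Q` in the cone modulo relations
  (`exists_cone_sub_cone`, sign split of each generator), so the crux is EQUIVALENT to AM–GM
  rigidity on the cone: `P² + Q² ∼ PQ + QP ⇒ P ∼ Q` (`reducedPeriodRing_iff_amgm_cone`). Values
  know `p² + q² = 2pq ⇒ p = q` because non-zero squares are positive; the calculus sees positivity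
  only after integration, while `(f − g) ⊗ (f − g)` changes sign — that gap is the difficulty.
cdisprove (refuter) file; companions `Negative/LoadBearing.lean`, `Negative/RingForms.lean`.
[Kontsevich–Zagier 2001, §1.2 rules (1)–(3), §4.1; Bochnak–Coste–Roy 1998, Thm. 2.2.1]
-/

noncomputable section

namespace Summit.KontsevichZagierPeriods.KontsevichZagierPeriods.ReducedPeriodRingNegative

open Literature.NumberTheory.Transcendental KZ
open Summit.KontsevichZagierPeriods.KontsevichZagierPeriods.Theses.FurushoPentagon

open MeasureTheory Set
open Literature.ModelTheory.ExponentialFields (IsSemialgebraic tarski_seidenberg_real_holds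
  isSemialgebraic_setOf_eval_eq_zero isSemialgebraic_setOf_eval_ne_zero)

variable {n : ℕ}

/-! Reused from the tree (`KZLogCalculusProofs.lean`): `KZ.of_mem_relations_of_volume_eq_zero`
(null domain ⇒ relation), `KZ.of_mem_relations_of_eqOn_zero` (zero integrand ⇒ relation),
`KZ.exists_zeroRep`, `KZ.of_sub_of_mem_relations_of_eqOn` (same domain, integrands agree on it ⇒
equivalent), `KZ.of_add_of_mem_relations_of_eqOn_neg`. -/

/-- The zero locus `{x ∈ σ | f x = 0}` of the integrand is `ℚ`-semialgebraic (graph elimination,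
Tarski–Seidenberg). [BCR 1998, Thm. 2.2.1] -/
theorem isSemialgebraic_sep_integrand_eq_zero (r : IntegralRep n) :
    IsSemialgebraic ℚ {x | x ∈ r.domain ∧ r.integrand x = 0} := by
  have hT : IsSemialgebraic ℚ {z : Fin (n + 1) → ℝ | z (Fin.last n) = 0} := by
    simpa using isSemialgebraic_setOf_eval_eq_zero (k := ℚ) (R := ℝ)
      (MvPolynomial.X (Fin.last n) : MvPolynomial (Fin (n + 1)) ℚ)
  convert r.isSemialgebraicFunOn_integrand.isSemialgebraic_sep_snoc_mem
    tarski_seidenberg_real_holds hT using 1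
  ext x
  simp

/-- The non-vanishing locus `{x ∈ σ | f x ≠ 0}` of the integrand is `ℚ`-semialgebraic. -/
theorem isSemialgebraic_sep_integrand_ne_zero (r : IntegralRep n) :
    IsSemialgebraic ℚ {x | x ∈ r.domain ∧ r.integrand x ≠ 0} := by
  have hT : IsSemialgebraic ℚ {z : Fin (n + 1) → ℝ | z (Fin.last n) ≠ 0} := by
    simpa using isSemialgebraic_setOf_eval_ne_zero (k := ℚ) (R := ℝ)
      (MvPolynomial.X (Fin.last n) : MvPolynomial (Fin (n + 1)) ℚ)
  convert r.isSemialgebraicFunOn_integrand.isSemialgebraic_sep_snoc_mem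
    tarski_seidenberg_real_holds hT using 1
  ext x
  simp

/-- **An a.e.-vanishing integrand gives a relation**: split `σ = {f = 0} ∪ {f ≠ 0}` (domain
additivity); the first piece has zero integrand, the second is null.
[Kontsevich–Zagier 2001, §1.2 rule (1)] -/
theorem of_mem_relations_of_volume_ne_zero (r : IntegralRep n)
    (h : volume {x | x ∈ r.domain ∧ r.integrand x ≠ 0} = 0) : of r ∈ relations := by
  set Z : Set (Fin n → ℝ) := {x | x ∈ r.domain ∧ r.integrand x = 0} with hZ
  set N : Set (Fin n → ℝ) := {x | x ∈ r.domain ∧ r.integrand x ≠ 0} with hN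
  have hZs : IsSemialgebraic ℚ Z := isSemialgebraic_sep_integrand_eq_zero r
  have hNs : IsSemialgebraic ℚ N := isSemialgebraic_sep_integrand_ne_zero r
  set rZ : IntegralRep n := r.restrict Z hZs (fun x hx => hx.1) with hrZ
  set rN : IntegralRep n := r.restrict N hNs (fun x hx => hx.1) with hrN
  have hZN : Z ∩ N = ∅ := by
    rw [Set.eq_empty_iff_forall_notMem]
    rintro x ⟨hxZ, hxN⟩
    exact hxN.2 hxZ.2
  have hsplit : of r - of rZ - of rN ∈ domainAddRel := by
    refine ⟨n, r, rZ, rN, ?_, ?_, fun _ _ => rfl, fun _ _ => rfl, rfl⟩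
    · ext x
      simp only [hrZ, hrN, IntegralRep.domain_restrict, mem_union, hZ, hN, mem_setOf_eq]
      tauto
    · simp [hrZ, hrN, hZN]
  have h1 := domainAddRel_subset_relations hsplit
  have h2 : of rZ ∈ relations := of_mem_relations_of_eqOn_zero rZ (fun x hx => hx.2)
  have h3 : of rN ∈ relations := of_mem_relations_of_volume_eq_zero rN h
  have heq : of r = (of r - of rZ - of rN) + of rZ + of rN := by abel
  rw [heq]
  exact relations.add_mem (relations.add_mem h1 h2) h3

/-- A non-negative integrand with integral `0` vanishes a.e. on the domain
(`MeasureTheory.setIntegral_eq_zero_iff_of_nonneg_ae`). [folklore] -/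
theorem volume_ne_zero_eq_zero_of_nonneg (r : IntegralRep n)
    (h0 : ∀ x ∈ r.domain, 0 ≤ r.integrand x) (hv : r.value = 0) :
    volume {x | x ∈ r.domain ∧ r.integrand x ≠ 0} = 0 := by
  have hmeas : MeasurableSet r.domain := IntegralRep.measurableSet_domain_holds r
  have hae : 0 ≤ᵐ[volume.restrict r.domain] r.integrand := by
    rw [Filter.EventuallyLE, ae_restrict_iff' hmeas]
    exact Filter.Eventually.of_forall h0
  have h := (setIntegral_eq_zero_iff_of_nonneg_ae hae r.integrableOn).mp hv
  rw [Filter.EventuallyEq, ae_restrict_iff' hmeas, ae_iff] at h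
  convert h using 2
  ext x
  simp [Classical.not_imp]

/-- **A non-negative representation of value `0` is a relation.** [folklore] -/
theorem of_mem_relations_of_nonneg_of_value_eq_zero (r : IntegralRep n)
    (h0 : ∀ x ∈ r.domain, 0 ≤ r.integrand x) (hv : r.value = 0) : of r ∈ relations :=
  of_mem_relations_of_volume_ne_zero r (volume_ne_zero_eq_zero_of_nonneg r h0 hv)

open MeasureTheory Set

/-! **The positive cone** `ℕ[non-negative representations] ⊆ FormalRep` is written out below as
`AddSubmonoid.closure (FreeAbelianGroup.of '' {x : Σ n, IntegralRep n | ∀ y ∈ x.2.domain, 0 ≤ x.2.integrand y})`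
(the additive submonoid generated by the generators `⟨n, [σ, f]⟩` with `f ≥ 0` on `σ`; it is the
`def cone` of the cdisprove work file). -/

/-- `[r] ∈ cone` for non-negative `r`. -/
theorem of_mem_cone {n : ℕ} (r : IntegralRep n) (hr : ∀ y ∈ r.domain, 0 ≤ r.integrand y) :
    of r ∈
    AddSubmonoid.closure (FreeAbelianGroup.of ''
      {x : Σ n, IntegralRep n | ∀ y ∈ x.2.domain, 0 ≤ x.2.integrand y}) :=
  AddSubmonoid.subset_closure ⟨⟨n, r⟩, hr, rfl⟩

/-- Elements of the cone evaluate non-negatively. -/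
theorem eval_nonneg_of_mem_cone {c : FormalRep} (hc : c ∈ AddSubmonoid.closure (FreeAbelianGroup.of ''
      {x : Σ n, IntegralRep n | ∀ y ∈ x.2.domain, 0 ≤ x.2.integrand y})) : 0 ≤ eval c := by
  induction hc using AddSubmonoid.closure_induction with
  | mem x hx =>
    obtain ⟨⟨n, r⟩, hr, rfl⟩ := hx
    change 0 ≤ eval (of r)
    rw [eval_of]
    exact setIntegral_nonneg (IntegralRep.measurableSet_domain_holds r) hr
  | zero => simp
  | add x y _ _ hx hy => rw [map_add]; exact add_nonneg hx hy

/-- **The kernel conjecture holds on the positive cone**: a sum of non-negative representations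
of total value `0` is a relation (each summand has value `0`, hence an a.e.-zero integrand). -/
theorem mem_relations_of_mem_cone_of_eval_eq_zero {c : FormalRep} (hc : c ∈ AddSubmonoid.closure (FreeAbelianGroup.of ''
      {x : Σ n, IntegralRep n | ∀ y ∈ x.2.domain, 0 ≤ x.2.integrand y}))
    (h0 : eval c = 0) : c ∈ relations := by
  induction hc using AddSubmonoid.closure_induction with
  | mem x hx =>
    obtain ⟨⟨n, r⟩, hr, rfl⟩ := hx
    change of r ∈ relations
    change eval (of r) = 0 at h0
    rw [eval_of] at h0
    exact of_mem_relations_of_nonneg_of_value_eq_zero r hr h0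
  | zero => exact relations.zero_mem
  | add x y hx hy ihx ihy =>
    rw [map_add] at h0
    have hx0 := eval_nonneg_of_mem_cone hx
    have hy0 := eval_nonneg_of_mem_cone hy
    exact relations.add_mem (ihx (by linarith)) (ihy (by linarith))

/-- **The crux holds on the positive cone** (and, symmetrically, on `-cone`): a counterexample
to `ReducedPeriodRing` is never a sum of non-negative representations — it needs signed
cancellation. -/
theorem reducedPeriodRing_on_cone {c : FormalRep} (hc : c ∈ AddSubmonoid.closure (FreeAbelianGroup.of ''
      {x : Σ n, IntegralRep n | ∀ y ∈ x.2.domain, 0 ≤ x.2.integrand y})) (h : c * c ∈ relations) :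
    c ∈ relations := by
  refine mem_relations_of_mem_cone_of_eval_eq_zero hc ?_
  have h0 : eval (c * c) = 0 := relations_le_ker_eval_holds h
  rw [eval_mul'] at h0
  exact mul_self_eq_zero.mp h0

/-- The symmetric statement on `-cone`. -/
theorem reducedPeriodRing_on_neg_cone {c : FormalRep} (hc : -c ∈ AddSubmonoid.closure (FreeAbelianGroup.of ''
      {x : Σ n, IntegralRep n | ∀ y ∈ x.2.domain, 0 ≤ x.2.integrand y})) (h : c * c ∈ relations) :
    c ∈ relations := by
  have h' : (-c) * (-c) ∈ relations := by simpa using h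
  simpa using relations.neg_mem (reducedPeriodRing_on_cone hc h')

/-- **AM–GM form of the crux.** For `P, Q` in the cone, `(P − Q)² ∈ relations` reads
`P² + Q² ∼ PQ + QP`; the crux for `c = P − Q` says this forces `P ∼ Q`. Since every formal
combination is `P − Q` with `P, Q` sums of generators, and — after splitting each generator along
the sign of its integrand, §4b — with `P, Q ∈ cone`, the crux is EQUIVALENT to this sign-free
rigidity statement (the decomposition half is `exists_cone_sub_cone` below). [folklore] -/
theorem reducedPeriodRing_iff_amgm_all :
    ReducedPeriodRing ↔
      ∀ P Q : FormalRep, P * P + Q * Q - (P * Q + Q * P) ∈ relations → P - Q ∈ relations := by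
  have key : ∀ P Q : FormalRep, (P - Q) * (P - Q) = P * P + Q * Q - (P * Q + Q * P) := by
    intro P Q; simp only [sub_mul, mul_sub]; abel
  constructor
  · intro h P Q hPQ
    exact h _ (by rw [key]; exact hPQ)
  · intro h c hc
    have := h c 0 (by simpa using hc)
    simpa using this

open MeasureTheory Set
open Literature.ModelTheory.ExponentialFields (IsSemialgebraic tarski_seidenberg_real_holds
  isSemialgebraic_setOf_eval_nonneg isSemialgebraic_setOf_eval_pos)

variable {n : ℕ}

/-- `[σ, f] + [σ, −f] ∈ relations` (integrand additivity `0 = f + (−f)`;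
`KZ.of_add_of_mem_relations_of_eqOn_neg`). [KZ 2001, §1.2 rule (1)] -/
theorem of_add_of_neg_mem_relations (r : IntegralRep n) : of r + of r.neg ∈ relations :=
  of_add_of_mem_relations_of_eqOn_neg (r := r) (r' := r.neg) rfl (fun _ _ => rfl)

/-- The non-negative locus `{x ∈ σ | 0 ≤ f x}` is `ℚ`-semialgebraic. [BCR 1998, Thm. 2.2.1] -/
theorem isSemialgebraic_sep_integrand_nonneg (r : IntegralRep n) :
    IsSemialgebraic ℚ {x | x ∈ r.domain ∧ 0 ≤ r.integrand x} := by
  have hT : IsSemialgebraic ℚ {z : Fin (n + 1) → ℝ | 0 ≤ z (Fin.last n)} := by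
    simpa using isSemialgebraic_setOf_eval_nonneg (k := ℚ) (R := ℝ)
      (MvPolynomial.X (Fin.last n) : MvPolynomial (Fin (n + 1)) ℚ)
  convert r.isSemialgebraicFunOn_integrand.isSemialgebraic_sep_snoc_mem
    tarski_seidenberg_real_holds hT using 1
  ext x
  simp

/-- The negative locus `{x ∈ σ | f x < 0}` is `ℚ`-semialgebraic. [BCR 1998, Thm. 2.2.1] -/
theorem isSemialgebraic_sep_integrand_neg (r : IntegralRep n) :
    IsSemialgebraic ℚ {x | x ∈ r.domain ∧ r.integrand x < 0} := by
  have hT : IsSemialgebraic ℚ {z : Fin (n + 1) → ℝ | z (Fin.last n) < 0} := by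
    have := isSemialgebraic_setOf_eval_pos (k := ℚ) (R := ℝ)
      (-(MvPolynomial.X (Fin.last n)) : MvPolynomial (Fin (n + 1)) ℚ)
    simpa using this
  convert r.isSemialgebraicFunOn_integrand.isSemialgebraic_sep_snoc_mem
    tarski_seidenberg_real_holds hT using 1
  ext x
  simp

/-- **Sign split of one representation**: `[σ, f] ∼ [σ₊, f] − [σ₋, −f]` with both pieces
non-negative (`σ₊ = {f ≥ 0}`, `σ₋ = {f < 0}`; domain additivity + `of_add_of_neg_mem_relations`).
[Kontsevich–Zagier 2001, §1.2 rule (1)] -/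
theorem exists_cone_sub_cone_of (r : IntegralRep n) :
    ∃ P Q : FormalRep, P ∈ AddSubmonoid.closure (FreeAbelianGroup.of '' {x : Σ n, IntegralRep n | ∀ y ∈ x.2.domain, 0 ≤ x.2.integrand y}) ∧ Q ∈ AddSubmonoid.closure (FreeAbelianGroup.of '' {x : Σ n, IntegralRep n | ∀ y ∈ x.2.domain, 0 ≤ x.2.integrand y}) ∧ of r - (P - Q) ∈ relations := by
  set Sp : Set (Fin n → ℝ) := {x | x ∈ r.domain ∧ 0 ≤ r.integrand x} with hSp
  set Sm : Set (Fin n → ℝ) := {x | x ∈ r.domain ∧ r.integrand x < 0} with hSm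
  have hSps : IsSemialgebraic ℚ Sp := isSemialgebraic_sep_integrand_nonneg r
  have hSms : IsSemialgebraic ℚ Sm := isSemialgebraic_sep_integrand_neg r
  set rp : IntegralRep n := r.restrict Sp hSps (fun x hx => hx.1) with hrp
  set rm : IntegralRep n := r.restrict Sm hSms (fun x hx => hx.1) with hrm
  have hdisj : Sp ∩ Sm = ∅ := by
    rw [Set.eq_empty_iff_forall_notMem]
    rintro x ⟨hxp, hxm⟩
    exact absurd hxm.2 (not_lt.mpr hxp.2)
  have hsplit : of r - of rp - of rm ∈ domainAddRel := by
    refine ⟨n, r, rp, rm, ?_, ?_, fun _ _ => rfl, fun _ _ => rfl, rfl⟩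
    · ext x
      simp only [hrp, hrm, IntegralRep.domain_restrict, mem_union, hSp, hSm, mem_setOf_eq]
      constructor
      · intro hx
        rcases le_or_gt 0 (r.integrand x) with h | h
        · exact Or.inl ⟨hx, h⟩
        · exact Or.inr ⟨hx, h⟩
      · rintro (⟨hx, -⟩ | ⟨hx, -⟩) <;> exact hx
    · simp [hrp, hrm, hdisj]
  refine ⟨of rp, of rm.neg, of_mem_cone rp (fun x hx => hx.2),
    of_mem_cone rm.neg (fun x hx => ?_), ?_⟩
  · have hx' : r.integrand x < 0 := hx.2
    simp only [IntegralRep.integrand_neg, Pi.neg_apply, hrm, IntegralRep.integrand_restrict]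
    linarith
  · have h1 := domainAddRel_subset_relations hsplit
    have h2 := of_add_of_neg_mem_relations rm
    have heq : of r - (of rp - of rm.neg) = (of r - of rp - of rm) + (of rm + of rm.neg) := by abel
    rw [heq]
    exact relations.add_mem h1 h2

/-- **Every formal combination is a difference of two cone elements modulo relations.** [folklore] -/
theorem exists_cone_sub_cone (c : FormalRep) :
    ∃ P Q : FormalRep, P ∈ AddSubmonoid.closure (FreeAbelianGroup.of '' {x : Σ n, IntegralRep n | ∀ y ∈ x.2.domain, 0 ≤ x.2.integrand y}) ∧ Q ∈ AddSubmonoid.closure (FreeAbelianGroup.of '' {x : Σ n, IntegralRep n | ∀ y ∈ x.2.domain, 0 ≤ x.2.integrand y}) ∧ c - (P - Q) ∈ relations := by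
  induction c using FreeAbelianGroup.induction_on with
  | zero => exact ⟨0, 0, AddSubmonoid.zero_mem _, AddSubmonoid.zero_mem _, by simp [relations.zero_mem]⟩
  | of x => obtain ⟨n, r⟩ := x; exact exists_cone_sub_cone_of r
  | neg x ih =>
    obtain ⟨P, Q, hP, hQ, h⟩ := ih
    refine ⟨Q, P, hQ, hP, ?_⟩
    have heq : -FreeAbelianGroup.of x - (Q - P) = -(FreeAbelianGroup.of x - (P - Q)) := by abel
    rw [heq]
    exact relations.neg_mem h
  | add x y hx hy =>
    obtain ⟨P, Q, hP, hQ, h⟩ := hx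
    obtain ⟨P', Q', hP', hQ', h'⟩ := hy
    refine ⟨P + P', Q + Q', AddSubmonoid.add_mem _ hP hP', AddSubmonoid.add_mem _ hQ hQ', ?_⟩
    have heq : x + y - (P + P' - (Q + Q')) = (x - (P - Q)) + (y - (P' - Q')) := by abel
    rw [heq]
    exact relations.add_mem h h'

/-- **The crux ⇔ AM–GM rigidity on the positive cone**: `ReducedPeriodRing` holds iff for all
sums `P, Q` of NON-NEGATIVE representations, a move chain `P² + Q² ∼ PQ + QP` forces `P ∼ Q`.
(Values: `p² + q² = 2pq` forces `p = q` in `ℝ` because squares of non-zero reals are POSITIVE; the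
calculus knows positivity only after integration — `mem_relations_of_mem_cone_of_eval_eq_zero` —
while `(P − Q)²` is not a cone element at the level of integrands: `(f−g)⊗(f−g)` changes sign.
That gap is the whole difficulty.) [folklore] -/
theorem reducedPeriodRing_iff_amgm_cone :
    ReducedPeriodRing ↔
      ∀ P Q : FormalRep, P ∈ AddSubmonoid.closure (FreeAbelianGroup.of '' {x : Σ n, IntegralRep n | ∀ y ∈ x.2.domain, 0 ≤ x.2.integrand y}) → Q ∈ AddSubmonoid.closure (FreeAbelianGroup.of '' {x : Σ n, IntegralRep n | ∀ y ∈ x.2.domain, 0 ≤ x.2.integrand y}) →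
        P * P + Q * Q - (P * Q + Q * P) ∈ relations → P - Q ∈ relations := by
  constructor
  · intro h P Q _ _ hPQ
    exact (reducedPeriodRing_iff_amgm_all.mp h) P Q hPQ
  · intro h c hc
    obtain ⟨P, Q, hP, hQ, hd⟩ := exists_cone_sub_cone c
    have key : (P - Q) * (P - Q) = P * P + Q * Q - (P * Q + Q * P) := by
      simp only [sub_mul, mul_sub]; abel
    -- `(P - Q)² ∼ c²` since `P - Q ∼ c` (two-sided ideal)
    have hd' : (P - Q) - c ∈ relations := by
      have := relations.neg_mem hd
      simpa using this
    have hsq : (P - Q) * (P - Q) - c * c ∈ relations := mul_sub_mul_mem_relations hd' hd'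
    have hPQ : P * P + Q * Q - (P * Q + Q * P) ∈ relations := by
      rw [← key]
      have := relations.add_mem hsq hc
      simpa using this
    have h1 : P - Q ∈ relations := h P Q hP hQ hPQ
    have := relations.add_mem hd h1
    simpa using this

end Summit.KontsevichZagierPeriods.KontsevichZagierPeriods.ReducedPeriodRingNegative
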